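import Mathlib
import Summits.MatrixMultiplication.MatrixMultiplication.Theses.StrassenDefect
import Literature.Computability.AlgebraicComplexity.GroupAlgebraTensor
import Literature.Computability.AlgebraicComplexity.SchoenhageTau
import Literature.Computability.AlgebraicComplexity.AsymptoticSpectrum
import Literature.Computability.AlgebraicComplexity.AsymptoticRankLimit
import Literature.Computability.AlgebraicComplexity.AsymptoticRankMatMul
import Literature.Computability.AlgebraicComplexity.CohnUmansTPPProofs
import Literature.Computability.AlgebraicComplexity.TensorRestrictionRank
import Literature.Computability.AlgebraicComplexity.FlatteningBound
import Literature.Barriers.MatrixMultiplication.UniversalMethodBarrierAsymptoticRank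

/-!
# `HalfSizeCoverAssembly` — near-lossless covers of `⟨n,n,n⟩` by half-size blocks force `ω(ℂ) = 2`

Route `StrassenDefect`, support item `stmt-MatrixMultiplication-4078` (`HalfSizeCoverAssembly`):

  (∀ ε > 0, ∃ n ≥ 1 and blocks `1 ≤ dᵢ ≤ n/2` with `⊕ᵢ ⟨dᵢ,dᵢ,dᵢ⟩ ⊵ ⟨n,n,n⟩` (degeneration,
   `PolyDegeneratesTo`) and `Σᵢ dᵢ² ≤ (1+ε)·n²`)  →  `MatrixMultiplication` (`ω(ℂ) = 2`).

Proof (Romani's generalized asymptotic sum inequality in asymptotic-rank form, exactly as in the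
route's rationale).  For one cover instance at `ε`:
`n^ω = R̃(⟨n,n,n⟩)` (`asymptoticRank_matMulTensor`) `≤ R̃(⊕ᵢ ⟨dᵢ,dᵢ,dᵢ⟩)` (`R̃` is monotone under
degeneration, `asymptoticRank_le_of_polyDegeneratesTo`) `≤ Σᵢ dᵢ^ω`
(`asymptoticRank_matMulDirectSum_le`: sub-additivity of `R̃` over the blocks, proved here from the
word expansion `(⊕ᵢ ⟨dᵢ⟩)^{⊗N} = Σ_J ⊗ₗ ⟨d_{J l}⟩` of the tree, as in Cohn–Umans 2003, proof of
Thm. 4.1), and `Σᵢ dᵢ^ω = Σᵢ dᵢ^{ω-2}·dᵢ² ≤ (n/2)^{ω-2}·(1+ε)·n²`; cancelling `n^{ω-2}·n² > 0` gives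
`2^{ω-2} ≤ 1 + ε` (`two_rpow_omega_sub_two_le_of_cover`).  Letting `ε → 0`, `2^{ω-2} ≤ 1`, so
`ω ≤ 2`; `ω ≥ 2` is the flattening bound `omega_two_le`.  The degenerate instances are harmless:
`p = 0` (no blocks) gives `n^ω ≤ 0`, impossible for `n ≥ 1`, and is covered by the same inequality.

References: F. Romani (1982), SIAM J. Comput. 11, 263–267 (generalized asymptotic sum inequality);
H. Cohn, C. Umans, FOCS 2003, Thm. 4.1 (proof); M. Bläser, *Fast Matrix Multiplication*, Theory of
Computing Library, Graduate Surveys 5 (2013), §7.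
-/

-- `Summit.MatrixMultiplication.MatrixMultiplication.…` is the tree's mandated summit-side namespace
-- (single-conjunct summit: Sub = Summit), which the `dupNamespace` linter would flag on every decl.
set_option linter.dupNamespace false

noncomputable section

open scoped BigOperators
open Literature.Computability.AlgebraicComplexity
open Literature.Barriers.MatrixMultiplication (PolyDegeneratesTo asymptoticRank_le_of_polyDegeneratesTo
  asymptoticRank_le_rpow)

namespace Summit.MatrixMultiplication.MatrixMultiplication.Theorems

/-- **Sub-additivity of the asymptotic rank over matrix-multiplication blocks**:
`R̃(⊕ᵢ ⟨dᵢ,dᵢ,dᵢ⟩) ≤ Σᵢ dᵢ^ω` (`dᵢ ≥ 1`, any field `K`).  Proof as in Cohn–Umans 2003, proof of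
Thm. 4.1: `R((⊕ᵢ ⟨dᵢ⟩)^{⊗N}) ≤ Σ_{J : Fin N → Fin r} R(⟨∏ₗ d_{J l}, …⟩) ≤ C_ε (Σᵢ dᵢ^{ω+ε})^N`
(`kroneckerPow_matMulDirectSum`, `tensorRank_blockPiTensor_le`,
`exists_tensorRank_matMulTensor_le_rpow`), then `N`-th roots, `N → ∞` (`le_of_pow_le_mul_pow`) and
`ε → 0` (`le_of_forall_pos_le_sum_rpow`).  Mirror image of the tree's
`sum_rpow_omega_le_asymptoticRank` (together: `R̃(⊕ᵢ⟨dᵢ⟩) = Σ dᵢ^ω`). -/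
theorem asymptoticRank_matMulDirectSum_le (K : Type) [Field K] {r : ℕ} (d : Fin r → ℕ)
    [∀ i, NeZero (d i)] :
    asymptoticRank (matMulDirectSum K d d d) ≤ ∑ i, (d i : ℝ) ^ omega K := by
  classical
  -- adapted from Summits/MatrixMultiplication/MatrixMultiplication/Cruxes/GradedPricing/SketchIdeator2.lean (2a)
  set D := matMulDirectSum K d d d with hD
  have hd : ∀ i, (0 : ℝ) < d i := fun i => by exact_mod_cast Nat.pos_of_ne_zero (NeZero.ne _)
  rcases Nat.eq_zero_or_pos r with hr | hr
  · -- no blocks: empty format, `D = 0`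
    subst hr
    have hD0 : D = 0 := by
      funext a
      exact a.1.elim0
    rw [hD0, asymptoticRank_zero]
    simp
  haveI : Nonempty (Fin r) := ⟨⟨0, hr⟩⟩
  have hR0 : 0 ≤ asymptoticRank D := asymptoticRank_nonneg D
  refine le_of_forall_pos_le_sum_rpow hd fun ε hε => ?_
  obtain ⟨C, hC, hCk⟩ := exists_tensorRank_matMulTensor_le_rpow K hε
  set B : ℝ := ∑ i, (d i : ℝ) ^ (omega K + ε) with hB
  have hb : 0 < B :=
    Finset.sum_pos (fun i _ => Real.rpow_pos_of_pos (hd i) _) Finset.univ_nonempty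
  refine le_of_pow_le_mul_pow (C := C) hb fun N => ?_
  rcases Nat.eq_zero_or_pos N with hN | hN
  · -- `N = 0`: `1 ≤ C`, from `1 ≤ R(⟨1,1,1⟩) ≤ C · 1^{ω+ε}`
    subst hN
    have h1 : (1 : ℝ) ≤ tensorRank (matMulTensor K 1 1 1) := by
      exact_mod_cast mul_le_tensorRank_matMulTensor K 1 1 1
    have h2 := hCk 1 le_rfl
    simp only [Nat.cast_one, Real.one_rpow, mul_one] at h2
    simpa using h1.trans h2
  -- `R(D^{⊗N}) ≤ C · B^N` (word expansion of the power of a direct sum, block by block)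
  have hDJ : ∀ J : Fin N → Fin r, 1 ≤ ∏ l, d (J l) := fun J =>
    Finset.prod_pos fun l _ => Nat.pos_of_ne_zero (NeZero.ne _)
  have hrank : (tensorRank (kroneckerPow D N) : ℝ) ≤ C * B ^ N := by
    have h1 : tensorRank (kroneckerPow D N) ≤ ∑ J : Fin N → Fin r,
        tensorRank (matMulTensor K (∏ l, d (J l)) (∏ l, d (J l)) (∏ l, d (J l))) := by
      rw [hD, kroneckerPow_matMulDirectSum]
      exact (tensorRank_sum_le _ _).trans
        (Finset.sum_le_sum fun J _ => tensorRank_blockPiTensor_le K d J)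
    have h2 : ∀ J : Fin N → Fin r,
        (tensorRank (matMulTensor K (∏ l, d (J l)) (∏ l, d (J l)) (∏ l, d (J l))) : ℝ) ≤
          C * ∏ l, (d (J l) : ℝ) ^ (omega K + ε) := fun J => by
      refine (hCk _ (hDJ J)).trans_eq ?_
      rw [Nat.cast_prod, Real.finsetProd_rpow _ _ fun l _ => (hd (J l)).le]
    calc (tensorRank (kroneckerPow D N) : ℝ)
        ≤ ∑ J : Fin N → Fin r,
            (tensorRank (matMulTensor K (∏ l, d (J l)) (∏ l, d (J l)) (∏ l, d (J l))) : ℝ) := by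
          exact_mod_cast h1
      _ ≤ ∑ J : Fin N → Fin r, C * ∏ l, (d (J l) : ℝ) ^ (omega K + ε) :=
          Finset.sum_le_sum fun J _ => h2 J
      _ = C * B ^ N := by rw [← Finset.mul_sum, hB, Fintype.sum_pow]
  -- `R̃(D)^N ≤ R(D^{⊗N})` (the asymptotic rank is the infimum of the `N`-th roots)
  have hpow : asymptoticRank D ^ N ≤ (tensorRank (kroneckerPow D N) : ℝ) := by
    have h := asymptoticRank_le_rpow D hN
    have hN' : (N : ℝ) ≠ 0 := by exact_mod_cast hN.ne'
    have := pow_le_pow_left₀ hR0 h N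
    rwa [← Real.rpow_natCast (((tensorRank (kroneckerPow D N) : ℕ) : ℝ) ^ ((N : ℝ)⁻¹)) N,
      ← Real.rpow_mul (Nat.cast_nonneg _), inv_mul_cancel₀ hN', Real.rpow_one] at this
  exact hpow.trans hrank

/-- **One cover instance bounds `2^{ω-2}`.**  If `⊕ᵢ ⟨dᵢ,dᵢ,dᵢ⟩ ⊵ ⟨n,n,n⟩` (degeneration) with
`n ≥ 1`, `1 ≤ dᵢ` and `2 dᵢ ≤ n` for all `i`, and `Σᵢ dᵢ² ≤ (1+ε)·n²`, then `2^{ω(ℂ)-2} ≤ 1 + ε`: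
`n^ω = R̃(⟨n⟩) ≤ R̃(⊕ᵢ⟨dᵢ⟩) ≤ Σ dᵢ^{ω-2} dᵢ² ≤ (n/2)^{ω-2} (1+ε) n²`, and `n^{ω-2} n² > 0` cancels
(Romani 1982 / Cohn–Umans 2003 bookkeeping). -/
theorem two_rpow_omega_sub_two_le_of_cover {n p : ℕ} {d : Fin p → ℕ} {ε : ℝ} (hn : 1 ≤ n)
    (hd : ∀ i, 1 ≤ d i ∧ 2 * d i ≤ n)
    (hdeg : PolyDegeneratesTo (matMulDirectSum ℂ d d d) (matMulTensor ℂ n n n))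
    (hsum : (∑ i, ((d i : ℕ) : ℝ) ^ 2) ≤ (1 + ε) * (n : ℝ) ^ 2) :
    (2 : ℝ) ^ (omega ℂ - 2) ≤ 1 + ε := by
  haveI : ∀ i, NeZero (d i) := fun i => ⟨by have := (hd i).1; omega⟩
  obtain ⟨s, hω⟩ : ∃ s : ℝ, omega ℂ = s + 2 := ⟨omega ℂ - 2, by ring⟩
  have hs : 0 ≤ s := by have := omega_two_le ℂ; linarith
  have hn0 : (0 : ℝ) < n := by exact_mod_cast hn
  have hA : (0 : ℝ) < (2 : ℝ) ^ s := Real.rpow_pos_of_pos two_pos s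
  have hdpos : ∀ i, (0 : ℝ) < d i := fun i => by exact_mod_cast (hd i).1
  have hdle : ∀ i, (d i : ℝ) ≤ n / 2 := fun i => by
    rw [le_div_iff₀ two_pos]
    have h' : (2 : ℝ) * d i ≤ n := by exact_mod_cast (hd i).2
    linarith
  -- `n^ω = R̃(⟨n,n,n⟩) ≤ R̃(⊕ᵢ ⟨dᵢ⟩) ≤ Σ dᵢ^ω`
  have h1 : (n : ℝ) ^ omega ℂ ≤ ∑ i, (d i : ℝ) ^ omega ℂ := by
    rw [← asymptoticRank_matMulTensor ℂ n hn]
    exact (asymptoticRank_le_of_polyDegeneratesTo hdeg).trans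
      (asymptoticRank_matMulDirectSum_le ℂ d)
  -- `dᵢ^ω = dᵢ^s dᵢ² ≤ (n/2)^s dᵢ²`
  have h2 : ∀ i, (d i : ℝ) ^ omega ℂ ≤ ((n : ℝ) ^ s / 2 ^ s) * (d i : ℝ) ^ 2 := fun i => by
    rw [hω, Real.rpow_add (hdpos i), Real.rpow_two]
    refine mul_le_mul_of_nonneg_right ?_ (sq_nonneg _)
    rw [← Real.div_rpow hn0.le zero_le_two]
    exact Real.rpow_le_rpow (hdpos i).le (hdle i) hs
  have h3 : (n : ℝ) ^ omega ℂ ≤ ((n : ℝ) ^ s / 2 ^ s) * ((1 + ε) * (n : ℝ) ^ 2) :=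
    calc (n : ℝ) ^ omega ℂ ≤ ∑ i, (d i : ℝ) ^ omega ℂ := h1
      _ ≤ ∑ i, ((n : ℝ) ^ s / 2 ^ s) * (d i : ℝ) ^ 2 := Finset.sum_le_sum fun i _ => h2 i
      _ = ((n : ℝ) ^ s / 2 ^ s) * ∑ i, (d i : ℝ) ^ 2 := by rw [Finset.mul_sum]
      _ ≤ ((n : ℝ) ^ s / 2 ^ s) * ((1 + ε) * (n : ℝ) ^ 2) :=
          mul_le_mul_of_nonneg_left hsum (by positivity)
  -- `n^ω = n^s n²`; cancel the positive factor `n^s n²`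
  rw [hω, Real.rpow_add hn0, Real.rpow_two] at h3
  have hP : (0 : ℝ) < (n : ℝ) ^ s * (n : ℝ) ^ 2 := by positivity
  have h4 : (n : ℝ) ^ s * (n : ℝ) ^ 2 * 1 ≤ (n : ℝ) ^ s * (n : ℝ) ^ 2 * ((1 + ε) / 2 ^ s) := by
    rw [mul_one]
    calc (n : ℝ) ^ s * (n : ℝ) ^ 2 ≤ ((n : ℝ) ^ s / 2 ^ s) * ((1 + ε) * (n : ℝ) ^ 2) := h3
      _ = (n : ℝ) ^ s * (n : ℝ) ^ 2 * ((1 + ε) / 2 ^ s) := by ring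
  have h5 : (1 : ℝ) ≤ (1 + ε) / 2 ^ s := le_of_mul_le_mul_left h4 hP
  rw [le_div_iff₀ hA, one_mul] at h5
  rwa [hω, add_sub_cancel_right]

/-- **`HalfSizeCoverAssembly` (support item `stmt-MatrixMultiplication-4078` of route
`StrassenDefect`): `HalfSizeBlockCover → ω(ℂ) = 2`.**  For every `ε > 0` a cover instance gives
`2^{ω-2} ≤ 1 + ε` (`two_rpow_omega_sub_two_le_of_cover`); hence `2^{ω-2} ≤ 1` and `ω ≤ 2`
(`1 < 2^{ω-2}` if `ω > 2`), while `ω ≥ 2` is the flattening bound `omega_two_le`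
(Romani 1982; Cohn–Umans 2003, Thm. 4.1; Bläser 2013, §7). -/
theorem HalfSizeCoverAssembly_proof :
    Summit.MatrixMultiplication.MatrixMultiplication.Theses.StrassenDefect.HalfSizeCoverAssembly := by
  unfold Summit.MatrixMultiplication.MatrixMultiplication.Theses.StrassenDefect.HalfSizeCoverAssembly
  intro hcover
  show omega ℂ = 2
  have h2 : (2 : ℝ) ≤ omega ℂ := omega_two_le ℂ
  refine le_antisymm ?_ h2
  have key : ∀ ε : ℝ, 0 < ε → (2 : ℝ) ^ (omega ℂ - 2) ≤ 1 + ε := fun ε hε => by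
    obtain ⟨n, p, d, hn, hd, hdeg, hsum⟩ := hcover ε hε
    exact two_rpow_omega_sub_two_le_of_cover hn hd hdeg hsum
  have hle : (2 : ℝ) ^ (omega ℂ - 2) ≤ 1 := le_of_forall_pos_le_add fun ε hε => key ε hε
  by_contra hcon
  have hlt : 0 < omega ℂ - 2 := by linarith [lt_of_not_ge hcon]
  have h1 : (1 : ℝ) < (2 : ℝ) ^ (omega ℂ - 2) := Real.one_lt_rpow one_lt_two hlt
  linarith

end Summit.MatrixMultiplication.MatrixMultiplication.Theorems

end
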